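import Mathlib
import Literature.AlgebraicGeometry.Resolution.BlowupPointDeltaDrop
import Literature.AlgebraicGeometry.Resolution.PermissibleCentres
import Literature.AlgebraicGeometry.Resolution.MonomialOrderReductionUnit
import Literature.AlgebraicGeometry.Resolution.EmbeddedResolution
import HarnessLib

/-!
# The total `δ`-invariant of a curve drops under blowing up a singular point

Topic: `Literature/AlgebraicGeometry/Resolution`. Global form of the `δ`-drop theorem
(`BlowupPointDeltaDrop.lean`; Kollár 2007, §1.4; the termination input "by embedded resolution of
curves" of Cossart–Piltant 2008, proof of Prop. 4.4, steps 1–2): for the blowing up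
`ρ : C' → C` of a closed point `x` of an integral locally Noetherian scheme `C` with
`dim 𝒪_{C,x} = 1` (a proper morphism; `C'` integral locally Noetherian), the **total `δ`-invariant**
`δ(C) = Σ_y δ(𝒪_{C,y})` (a finite sum) satisfies **`δ(C') < δ(C)` when `x` is a singular point**
(`IsBlowup.finsum_pointDelta_lt`), and the support of `δ` on `C'` stays finite: off `x` the
blowing up is a local isomorphism (`IsBlowup.isIso_stalkMap_of_not_mem_support`,
`existsUnique_preimage_of_isIso_morphismRestrict`), so `δ` is unchanged there, while over `x`
the finitely many points `x'` have `Σ δ(x') < δ(x)` (`IsBlowup.sum_curveDelta_fibre_lt`). Hence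
blowing up singular points of a curve terminates after at most `δ(C)` steps. All PROVED; the
hypotheses "finite normalization" and "`δ < ∞` everywhere" hold for quasi-excellent curves.

* `pointDelta C y = δ(𝒪_{C,y})`, `pointDelta_eq_of_isIso_stalkMap`;
* `IsBlowup.pointDelta_eq_of_ne`, `IsBlowup.existsUnique_preimage_of_ne` — off the centre;
* `IsBlowup.finite_support_pointDelta` — finiteness of the support of `δ` on `C'`;
* `IsBlowup.finsum_pointDelta_lt` — **`Σ_{y'} δ(y') < Σ_y δ(y)`** (for any centre `J` with
  support `{x}` and `J_x = 𝔪_x`), `IsBlowup.finsum_pointDelta_lt_of_vanishingIdeal` (the reduced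
  point).

## Sources

* J. Kollár, *Lectures on Resolution of Singularities* (2007), §1.4. [Kollar2007]
* V. Cossart, O. Piltant, J. Algebra 320 (2008), proof of Prop. 4.4, p. 10. [CossartPiltant2008]
-/

noncomputable section

open CategoryTheory AlgebraicGeometry TopologicalSpace IsLocalRing

namespace Literature.AlgebraicGeometry.Resolution

universe u

open Scheme.IdealSheafData

/-! ## `δ` at a point -/

/-- **`δ(𝒪_{C,y})`**, the `δ`-invariant of the local ring of the integral scheme `C` at `y` (with
the function field as fraction field). [cite: Kollar2007, §1.4] -/
def pointDelta (C : Scheme.{u}) [IsIntegral C] (y : C) : ℕ∞ :=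
  curveDelta (C.presheaf.stalk y) C.functionField

/-- `δ` is unchanged at points where the stalk map is an isomorphism. [folklore] -/
theorem pointDelta_eq_of_isIso_stalkMap {C' C : Scheme.{u}} [IsIntegral C] [IsIntegral C']
    (f : C' ⟶ C) (y' : C') [IsIso (f.stalkMap y')] : pointDelta C' y' = pointDelta C (f y') :=
  (curveDelta_eq_of_ringEquiv (asIso (f.stalkMap y')).commRingCatIsoToRingEquiv
    C.functionField C'.functionField).symm

section PointBlowup

variable {C' C : Scheme.{u}} [IsIntegral C] [IsIntegral C'] [IsLocallyNoetherian C]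
  [IsLocallyNoetherian C'] {ρ : C' ⟶ C} {J : C.IdealSheafData} {x : C}
  (hρ : IsBlowup ρ J) (hsuppJ : (J.support : Set C) = {x})

omit [IsLocallyNoetherian C] [IsLocallyNoetherian C'] in
include hρ hsuppJ in
/-- Off `x` the `δ`-invariant is unchanged. [cite: Kollar2007, §1.4] -/
theorem IsBlowup.pointDelta_eq_of_ne {y' : C'} (hy' : ρ y' ≠ x) :
    pointDelta C' y' = pointDelta C (ρ y') := by
  haveI := hρ.isIso_stalkMap_of_not_mem_support (x' := y') (by
    change ρ y' ∉ (J.support : Set C)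
    rw [hsuppJ]; exact hy')
  exact pointDelta_eq_of_isIso_stalkMap ρ y'

omit [IsIntegral C] [IsIntegral C'] [IsLocallyNoetherian C] [IsLocallyNoetherian C'] in
include hρ hsuppJ in
/-- Off `x` every point has exactly one preimage. [cite: StacksProject, Tag 02OS] -/
theorem IsBlowup.existsUnique_preimage_of_ne {y : C} (hy : y ≠ x) : ∃! y' : C', ρ y' = y := by
  refine existsUnique_preimage_of_isIso_morphismRestrict ρ hρ.isIso_compl ?_
  change y ∈ ((J.support : Set C))ᶜ
  rw [hsuppJ]
  exact hy

variable [IsProper ρ]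
  [Module.Finite (C.presheaf.stalk x) (integralClosure (C.presheaf.stalk x) C.functionField)]
  (hJx : stalkIdeal J x = maximalIdeal (C.presheaf.stalk x))
  (hdim : ringKrullDim (C.presheaf.stalk x) = 1)
  (hfin : ∀ x' : C', ρ x' = x →
    Module.Finite (C'.presheaf.stalk x') (integralClosure (C'.presheaf.stalk x') C'.functionField))

include hρ hsuppJ hJx hdim hfin in
/-- **The support of `δ` on `C'` is finite** if it is finite on `C`. [cite: Kollar2007, §1.4] -/
theorem IsBlowup.finite_support_pointDelta (hsupp : (Function.support (pointDelta C)).Finite) :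
    (Function.support (pointDelta C')).Finite := by
  have hF : ({y' : C' | ρ y' = x}).Finite := Set.finite_coe_iff.mp (hρ.finite_fibre x hJx hdim hfin)
  have hT : (ρ ⁻¹' (Function.support (pointDelta C) \ {x})).Finite := by
    refine Set.Finite.preimage (fun y' hy' y'' hy'' h => ?_) (hsupp.subset Set.sdiff_subset)
    have hne : ρ y' ≠ x := hy'.2
    exact (hρ.existsUnique_preimage_of_ne hsuppJ hne).unique rfl h.symm
  refine (hF.union hT).subset fun y' hy' => ?_
  by_cases h : ρ y' = x
  · exact Or.inl h
  · refine Or.inr ⟨?_, h⟩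
    rw [Function.mem_support, ← hρ.pointDelta_eq_of_ne hsuppJ h]
    exact hy'

include hρ hsuppJ hJx hdim hfin in
/-- **`δ(C') < δ(C)` for the blowing up of a singular point `x`** of the curve `C`: the total
`δ`-invariant `Σ_y δ(𝒪_{C,y})` drops strictly (Kollár 2007, §1.4; termination of steps 1–2 of the
algorithm of Cossart–Piltant 2008, Prop. 4.4). [cite: Kollar2007, §1.4]
[cite: CossartPiltant2008, proof of Prop. 4.4, p. 10] -/
theorem IsBlowup.finsum_pointDelta_lt (hsupp : (Function.support (pointDelta C)).Finite)
    (htop : ∀ y : C, pointDelta C y ≠ ⊤) (hsing : ¬ IsDiscreteValuationRing (C.presheaf.stalk x)) :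
    ∑ᶠ y' : C', pointDelta C' y' < ∑ᶠ y : C, pointDelta C y := by
  classical
  have hsd : (Function.support (pointDelta C) \ {x}).Finite := hsupp.subset Set.sdiff_subset
  -- the two pieces of the support upstairs
  have hF : ({y' : C' | ρ y' = x}).Finite := Set.finite_coe_iff.mp (hρ.finite_fibre x hJx hdim hfin)
  have hinj : Set.InjOn ρ {y' : C' | ρ y' ≠ x} := fun y' hy' y'' _ h =>
    (hρ.existsUnique_preimage_of_ne hsuppJ hy').unique rfl h.symm
  have hT : (ρ ⁻¹' (Function.support (pointDelta C) \ {x})).Finite :=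
    Set.Finite.preimage (hinj.mono fun y' hy' => hy'.2) hsd
  -- finsum upstairs as a sum over `F ∪ T`
  have hsupp' : Function.support (pointDelta C') ⊆ ↑(hF.toFinset ∪ hT.toFinset) := by
    intro y' hy'
    rw [Finset.coe_union, Set.Finite.coe_toFinset, Set.Finite.coe_toFinset]
    by_cases h : ρ y' = x
    · exact Or.inl h
    · refine Or.inr ⟨?_, h⟩
      rw [Function.mem_support, ← hρ.pointDelta_eq_of_ne hsuppJ h]
      exact hy'
  have hdisj : Disjoint hF.toFinset hT.toFinset := by
    rw [Finset.disjoint_left]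
    intro y' h1 h2
    rw [Set.Finite.mem_toFinset] at h1 h2
    exact h2.2 h1
  rw [finsum_eq_sum_of_support_subset _ hsupp', Finset.sum_union hdisj]
  -- the sum over the fibre
  have hfib : ∑ y' ∈ hF.toFinset, pointDelta C' y' =
      ∑ᶠ i : {x' : C' // ρ x' = x}, curveDelta (C'.presheaf.stalk i.1) C'.functionField := by
    haveI : Fintype {x' : C' // ρ x' = x} := hF.fintype
    rw [finsum_eq_sum_of_fintype, ← Finset.sum_coe_sort]
    refine Finset.sum_equiv (Equiv.subtypeEquiv (Equiv.refl _) fun y' => ?_) ?_ ?_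
    · simp
    · simp
    · intro i _; rfl
  have hlt := hρ.sum_curveDelta_fibre_lt x hJx hdim hfin hsing
  rw [← hfib] at hlt
  -- the sum off the fibre is the sum downstairs off `x`
  have hT' : ∑ y' ∈ hT.toFinset, pointDelta C' y' =
      ∑ y ∈ hsd.toFinset, pointDelta C y := by
    have himage : (hT.toFinset).image ρ = hsd.toFinset := by
      ext y
      rw [Finset.mem_image, Set.Finite.mem_toFinset]
      constructor
      · rintro ⟨y', hy', rfl⟩
        rw [Set.Finite.mem_toFinset] at hy'
        exact hy'
      · intro hy
        obtain ⟨y', hy', -⟩ := hρ.existsUnique_preimage_of_ne hsuppJ (y := y) hy.2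
        refine ⟨y', ?_, hy'⟩
        rw [Set.Finite.mem_toFinset, Set.mem_preimage, hy']
        exact hy
    rw [← himage, Finset.sum_image]
    · refine Finset.sum_congr rfl fun y' hy' => ?_
      rw [Set.Finite.mem_toFinset] at hy'
      exact hρ.pointDelta_eq_of_ne hsuppJ hy'.2
    · intro y' hy' y'' hy'' h
      rw [Finset.mem_coe, Set.Finite.mem_toFinset] at hy' hy''
      exact hinj hy'.2 hy''.2 h
  rw [hT']
  -- downstairs: `x` is in the support (it is singular)
  have hx0 : pointDelta C x ≠ 0 := by
    rw [pointDelta, Ne, curveDelta_eq_zero_iff_isDiscreteValuationRing C.functionField hdim]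
    exact hsing
  have hxs : x ∈ hsupp.toFinset := by
    rw [Set.Finite.mem_toFinset]; exact hx0
  have hdown : ∑ᶠ y : C, pointDelta C y =
      pointDelta C x + ∑ y ∈ hsd.toFinset, pointDelta C y := by
    rw [finsum_eq_sum_of_support_subset _ (by simp : Function.support (pointDelta C) ⊆ ↑hsupp.toFinset),
      ← Finset.add_sum_erase _ _ hxs]
    congr 1
    refine Finset.sum_congr ?_ fun _ _ => rfl
    ext y
    simp [Finset.mem_erase, Set.Finite.mem_toFinset, and_comm]
  rw [hdown]
  -- conclude
  have hrest : ∑ y ∈ hsd.toFinset, pointDelta C y ≠ ⊤ :=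
    ENat.sum_ne_top.mpr fun y _ => htop y
  calc ∑ y' ∈ hF.toFinset, pointDelta C' y' +
        ∑ y ∈ hsd.toFinset, pointDelta C y
      < pointDelta C x + ∑ y ∈ hsd.toFinset, pointDelta C y := by
        exact (ENat.add_lt_add_iff_right hrest).mpr hlt

/-- The case of the blowing up of the reduced closed point `{x}` (`J = 𝓘_{{x}}`: support `{x}`,
stalk `𝔪_x`). [cite: Kollar2007, §1.4] -/
theorem IsBlowup.finsum_pointDelta_lt_of_vanishingIdeal {C' C : Scheme.{u}} [IsIntegral C]
    [IsIntegral C'] [IsLocallyNoetherian C] [IsLocallyNoetherian C'] {ρ : C' ⟶ C} {x : C}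
    (hx : IsClosed ({x} : Set C)) (hρ : IsBlowup ρ (vanishingIdeal ⟨{x}, hx⟩)) [IsProper ρ]
    [Module.Finite (C.presheaf.stalk x) (integralClosure (C.presheaf.stalk x) C.functionField)]
    (hdim : ringKrullDim (C.presheaf.stalk x) = 1)
    (hfin : ∀ x' : C', ρ x' = x →
      Module.Finite (C'.presheaf.stalk x') (integralClosure (C'.presheaf.stalk x') C'.functionField))
    (hsupp : (Function.support (pointDelta C)).Finite) (htop : ∀ y : C, pointDelta C y ≠ ⊤)
    (hsing : ¬ IsDiscreteValuationRing (C.presheaf.stalk x)) :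
    (Function.support (pointDelta C')).Finite ∧
      ∑ᶠ y' : C', pointDelta C' y' < ∑ᶠ y : C, pointDelta C y :=
  have hs : ((vanishingIdeal (⟨{x}, hx⟩ : Closeds C)).support : Set C) = {x} :=
    Scheme.IdealSheafData.coe_support_vanishingIdeal _
  have hJx := stalkIdeal_vanishingIdeal_singleton (X := C) hx
  ⟨hρ.finite_support_pointDelta hs hJx hdim hfin hsupp,
    hρ.finsum_pointDelta_lt hs hJx hdim hfin hsupp htop hsing⟩

end PointBlowup

end Literature.AlgebraicGeometry.Resolution

end
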